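import Mathlib
import HarnessLib
import Summits.ValiantsHypothesis.ValiantsHypothesis.Theorems.KPlusLogSqLawWeakLiftingTowerGraftWronskianKFourConsecutive
import Summits.ValiantsHypothesis.ValiantsHypothesis.Theorems.KPlusLogSqLawWeakLiftingTowerGraftWronskianKFourReflect

/-!
# Tower graft line — CONJECTURE W AT `K = 4` ON THE HOMOTHETIC CONSECUTIVE-SUMSET SUPPORTS `(c, c+2h, c+3h, c+4h)` AND THEIR MIRRORS `(c, c+h, c+2h, c+4h)`

Helper file for LINE (B) `Cruxes/WeakLifting/Lines/tower_graft.lean` (crux `WeakLifting` = stmt-ValiantsHypothesis-19561), on the located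
target (W-4) = `ConjectureWAt 4` («`Z₊(W(u,v)) ≤ 4` for two real `4`-nomials on a common support»).  NO stub is claimed.

`…WronskianKFourConsecutive.card_posRoots_wronskian_four_le_four_consecutive` (this hand) proves Conjecture W at `K = 4` on the supports
`(c, c+2, c+3, c+4)`.  Here the two routine symmetries of the problem transport it:

* `fewnomial_scaled_eq`, ★ `card_posRoots_wronskian_scaled_le` — support HOMOTHETY `d = c + h·g` (`h ≥ 1`): `Z₊(W)` on `c + h·g` is at most
  `Z₊(W)` on `g` (`X·`-shift and `x ↦ x^h`, injective on `(0,∞)`; same mechanism as `…WronskianDevelopable.card_posRoots_wronskian_arith_le`);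
* ★★ `card_posRoots_wronskian_four_le_four_consecutive_scaled` — `Z₊(W(u,v)) ≤ 4` on every support `(c, c+2h, c+3h, c+4h)`, `h ≥ 1`
  (all supports of the open cell `d₀+d₃ < d₁+d₂` whose pair sums form an ARITHMETIC PROGRESSION);
* ★★ `card_posRoots_wronskian_four_le_four_consecutive_mirror` — `Z₊(W(u,v)) ≤ 4` on every support `(c, c+h, c+2h, c+4h)`, `h ≥ 1` (the
  other orientation `d₁+d₂ < d₀+d₃`; support reflection `x ↦ 1/x`, `…KFourReflect.card_posRoots_wronskian_le_reflect`).

HONEST FRAMING: two 2-parameter support families; `ConjectureWAt 4` stays OPEN; nothing on S4/S4f/S5/S5ᴸ, TowerB, `WeakLifting`,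
Conjecture B, `MatrixDescartes` (18050), `VP ≠ VNP`.  Def-free.  Seat: prover leafhand-val-kpluslogsqlaw-1 g12, `--supports
stmt-ValiantsHypothesis-19561 --as helper`.  [folklore symmetries; this work]
-/

-- `Summit.ValiantsHypothesis.ValiantsHypothesis.…` repeats a component by the D-0017 layout
-- (single-conjunct summit), which the `dupNamespace` linter flags; the name is mandated.
set_option linter.dupNamespace false
set_option autoImplicit false

namespace Summit.ValiantsHypothesis.ValiantsHypothesis.Theorems.KPlusLogSqLaw.TowerGraft

open Polynomial Finset
open scoped BigOperators Polynomial

namespace WronskianDevelopable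

/-- a fewnomial on the homothetic support `c + h·g` is `X^c · ũ(X^h)`. [folklore] -/
theorem fewnomial_scaled_eq {K : ℕ} (u : Fin K → ℝ) (g : Fin K → ℕ) (c h : ℕ) :
    (∑ l : Fin K, C (u l) * (X : ℝ[X]) ^ (c + h * g l)) =
      X ^ c * (∑ l : Fin K, C (u l) * (X : ℝ[X]) ^ (g l)).comp (X ^ h) := by
  rw [Polynomial.sum_comp, Finset.mul_sum]
  refine Finset.sum_congr rfl fun l _ => ?_
  rw [mul_comp, C_comp, X_pow_comp, pow_add, pow_mul]
  ring

/-- ★ **support homothety does not increase `Z₊(W)` beyond the base support**: `#Z₊(W)` on `c + h·g` (`h ≥ 1`) is at most `#Z₊(W)` on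
`g`. [folklore; this work] -/
theorem card_posRoots_wronskian_scaled_le {K : ℕ} (u v : Fin K → ℝ) (g : Fin K → ℕ) (c h : ℕ) (hh : 0 < h) :
    ((wronskian (∑ l : Fin K, C (u l) * (X : ℝ[X]) ^ (c + h * g l))
        (∑ l : Fin K, C (v l) * (X : ℝ[X]) ^ (c + h * g l))).roots.toFinset.filter (fun x => 0 < x)).card ≤
      ((wronskian (∑ l : Fin K, C (u l) * (X : ℝ[X]) ^ (g l))
        (∑ l : Fin K, C (v l) * (X : ℝ[X]) ^ (g l))).roots.toFinset.filter (fun x => 0 < x)).card := by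
  classical
  set ud : ℝ[X] := ∑ l : Fin K, C (u l) * (X : ℝ[X]) ^ (g l) with hud
  set vd : ℝ[X] := ∑ l : Fin K, C (v l) * (X : ℝ[X]) ^ (g l) with hvd
  rw [fewnomial_scaled_eq u g c h, fewnomial_scaled_eq v g c h, wronskian_mul_mul, wronskian_comp]
  set W : ℝ[X] := wronskian ud vd with hWdef
  by_cases hW0 : W = 0
  · simp [hW0]
  have hmaps : ∀ x ∈ (((X : ℝ[X]) ^ c) ^ 2 * (derivative ((X : ℝ[X]) ^ h) * W.comp (X ^ h))).roots.toFinset.filter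
      (fun x => 0 < x), x ^ h ∈ W.roots.toFinset.filter (fun x => 0 < x) := by
    intro x hx
    rw [Finset.mem_filter, Multiset.mem_toFinset] at hx ⊢
    obtain ⟨hxr, hxpos⟩ := hx
    obtain ⟨-, hroot⟩ := mem_roots'.mp hxr
    simp only [IsRoot, eval_mul, eval_pow, eval_X, eval_comp, derivative_X_pow, eval_C] at hroot
    have hxne : x ≠ 0 := ne_of_gt hxpos
    have h1 : (x ^ c) ^ 2 ≠ 0 := pow_ne_zero _ (pow_ne_zero _ hxne)
    have h2 : (h : ℝ) * x ^ (h - 1) ≠ 0 := mul_ne_zero (Nat.cast_ne_zero.mpr hh.ne') (pow_ne_zero _ hxne)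
    have hWx : W.eval (x ^ h) = 0 := by
      rcases mul_eq_zero.mp hroot with h' | h'
      · exact absurd h' h1
      · rcases mul_eq_zero.mp h' with h'' | h''
        · exact absurd h'' h2
        · exact h''
    exact ⟨(mem_roots hW0).mpr hWx, pow_pos hxpos h⟩
  have hinj : Set.InjOn (fun x : ℝ => x ^ h)
      ((((X : ℝ[X]) ^ c) ^ 2 * (derivative ((X : ℝ[X]) ^ h) * W.comp (X ^ h))).roots.toFinset.filter
        (fun x => 0 < x) : Set ℝ) := by
    intro x hx y hy hxy
    rw [Finset.coe_filter, Set.mem_setOf_eq] at hx hy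
    exact (pow_left_strictMonoOn₀ hh.ne').injOn hx.2.le hy.2.le hxy
  exact Finset.card_le_card_of_injOn _ hmaps hinj

/-- ★★ **CONJECTURE W AT `K = 4` ON THE SUPPORTS `(c, c+2h, c+3h, c+4h)`** (`h ≥ 1`; the supports of the open cell whose pair sums
form an arithmetic progression): `Z₊(W(u,v)) ≤ 4` for all real `u, v`. [this work] -/
theorem card_posRoots_wronskian_four_le_four_consecutive_scaled (u v : Fin 4 → ℝ) (c h : ℕ) (hh : 0 < h) :
    ((wronskian (∑ l, C (u l) * (X : ℝ[X]) ^ (![c, c + 2 * h, c + 3 * h, c + 4 * h] : Fin 4 → ℕ) l)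
        (∑ l, C (v l) * (X : ℝ[X]) ^ (![c, c + 2 * h, c + 3 * h, c + 4 * h] : Fin 4 → ℕ) l)).roots.toFinset.filter
      (fun x => 0 < x)).card ≤ 4 := by
  have hfun : (![c, c + 2 * h, c + 3 * h, c + 4 * h] : Fin 4 → ℕ) = fun l => c + h * (![0, 2, 3, 4] : Fin 4 → ℕ) l := by
    funext l; fin_cases l <;> simp <;> ring
  rw [hfun]
  refine (card_posRoots_wronskian_scaled_le u v _ c h hh).trans ?_
  have h0 : (![0, 2, 3, 4] : Fin 4 → ℕ) = ![0, 0 + 2, 0 + 3, 0 + 4] := by norm_num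
  rw [h0]
  exact card_posRoots_wronskian_four_le_four_consecutive u v 0

/-- ★★ **CONJECTURE W AT `K = 4` ON THE MIRROR SUPPORTS `(c, c+h, c+2h, c+4h)`** (`h ≥ 1`; orientation `d₁+d₂ < d₀+d₃`):
`Z₊(W(u,v)) ≤ 4` for all real `u, v` (support reflection onto `(0, 2h, 3h, 4h)`). [this work] -/
theorem card_posRoots_wronskian_four_le_four_consecutive_mirror (u v : Fin 4 → ℝ) (c h : ℕ) (hh : 0 < h) :
    ((wronskian (∑ l, C (u l) * (X : ℝ[X]) ^ (![c, c + h, c + 2 * h, c + 4 * h] : Fin 4 → ℕ) l)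
        (∑ l, C (v l) * (X : ℝ[X]) ^ (![c, c + h, c + 2 * h, c + 4 * h] : Fin 4 → ℕ) l)).roots.toFinset.filter
      (fun x => 0 < x)).card ≤ 4 := by
  set d : Fin 4 → ℕ := ![c, c + h, c + 2 * h, c + 4 * h] with hd
  have hD : ∀ l, d l ≤ c + 4 * h := by
    intro l; fin_cases l <;> simp [hd] <;> omega
  refine (card_posRoots_wronskian_le_reflect u v d (c + 4 * h) hD).trans ?_
  have hexp : ∀ l : Fin 4, c + 4 * h - d (Fin.rev l) = 0 + h * (![0, 2, 3, 4] : Fin 4 → ℕ) l := by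
    intro l
    fin_cases l
    · show c + 4 * h - d (Fin.rev 0) = 0 + h * 0
      have : Fin.rev (0 : Fin 4) = 3 := by decide
      rw [this]; simp [hd]
    · show c + 4 * h - d (Fin.rev 1) = 0 + h * 2
      have : Fin.rev (1 : Fin 4) = 2 := by decide
      rw [this]; simp [hd]; omega
    · show c + 4 * h - d (Fin.rev 2) = 0 + h * 3
      have : Fin.rev (2 : Fin 4) = 1 := by decide
      rw [this]; simp [hd]; omega
    · show c + 4 * h - d (Fin.rev 3) = 0 + h * 4
      have : Fin.rev (3 : Fin 4) = 0 := by decide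
      rw [this]; simp [hd]; omega
  simp_rw [hexp]
  refine (card_posRoots_wronskian_scaled_le (fun l => u (Fin.rev l)) (fun l => v (Fin.rev l)) _ 0 h hh).trans ?_
  have h0 : (![0, 2, 3, 4] : Fin 4 → ℕ) = ![0, 0 + 2, 0 + 3, 0 + 4] := by norm_num
  rw [h0]
  exact card_posRoots_wronskian_four_le_four_consecutive _ _ 0

end WronskianDevelopable

end Summit.ValiantsHypothesis.ValiantsHypothesis.Theorems.KPlusLogSqLaw.TowerGraft
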